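import Summits.ValiantsHypothesis.ValiantsHypothesis.Theses.DivisionGap
import Literature.Computability.AlgebraicComplexity.ArithCircuitProofs
import Literature.Computability.AlgebraicComplexity.DetInVP

/-!
# `DivisionGap.PerDivisionHard` (stmt-ValiantsHypothesis-5065): load-bearing hypotheses and the
tightness window — negative knowledge from the standing disprover

The crux `PerDivisionHard` (H1 of route DivisionGap) reads
`∀ c, ∃ n₀, ∀ n ≥ n₀, ∀ h : ℝ≥0[x_ij], h ≠ 0 → 2 ^ ((Nat.log 2 n + c) ^ c) < L(per_n · h) + L(h)`
with `L = complexity` over the semiring `ℝ≥0` (monotone fan-in-two circuits; the Hrubeš–Yehudayoff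
normal form of one division).  All statements below are INLINE variants of it (no new named facts):

* `perDivisionHard_false_without_nonzero` — with `h ≠ 0` deleted the statement is false (`h = 0`).
* `perDivisionHard_false_without_threshold` — claimed for every `n` (no `n₀`) it is false: at `n = 0`
  the permanent is `1` and the pair `(per_0 · 1, 1)` costs `0` gates (likewise `n = 1`,
  `pair_at_one_eq_zero`).
* `perDivisionHard_false_uniform` — with the quantifiers swapped (`∃ n₀ ∀ c`) it is false: the
  threshold `2^{(log n₀ + c)^c}` is unbounded in `c`.
* `perDivisionHard_false_of_charTwo` — with the coefficient semiring `ℝ≥0` replaced by any nontrivial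
  commutative ring of characteristic two it is false: `per = det` there and `L(det_n) ≤ 8(n+1)^7`
  (Berkowitz; tree `complexity_detPoly_le`).  So every proof must use the absence of cancellation in
  `ℝ≥0`; over fields of characteristic `≠ 2` the analogue is the open one-division form of `per ∉ VQP`.
* `exists_pair_le_factorial`, `perDivisionHard_false_at_factorial_rate` — the tightness window: the
  trivial pair `h = 1` costs at most `(n+1)·n!`, so the quasi-polynomial threshold of the crux cannot be
  raised to `(n+1)·n!` (Jerrum–Snir's Laplace circuit even gives `n·2^n`).

Why no refutation of the crux itself is attempted here: `¬ PerDivisionHard` would give, by Strassen's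
elimination of the single division, quasi-polynomial circuits over `ℝ` for `per_n` for infinitely many
`n` — the failure of the (a.e.) extended Valiant hypothesis.  See `Cruxes/PerDivisionHard/Disproof.lean`.
-/

noncomputable section

namespace Summit.ValiantsHypothesis.Theorems.PerDivisionHardNegative

open Literature.Computability.AlgebraicComplexity MvPolynomial
open scoped NNReal

section Facts

variable {k : Type} [CommSemiring k] {σ : Type}

/-- `L(0) = 0` (the constant `0` is a free input). [folklore] -/
theorem complexity_zero : complexity (0 : MvPolynomial σ k) = 0 := by
  simpa using complexity_C_holds (σ := σ) (0 : k)

/-- `L(1) = 0` (the constant `1` is a free input). [folklore] -/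
theorem complexity_one : complexity (1 : MvPolynomial σ k) = 0 := by
  simpa using complexity_C_holds (σ := σ) (1 : k)

/-- `L(per_n) ≤ (n + 1) · n!` over any commutative semiring: the permanent is the sum of its `n!`
permutation monomials, each a product of `n` free variables. [folklore] -/
theorem complexity_perPoly_le_factorial (n : ℕ) :
    complexity (perPoly (Fin n) k) ≤ (n + 1) * n.factorial := by
  classical
  unfold perPoly Matrix.permanent
  have hprod : ∀ ρ : Equiv.Perm (Fin n),
      complexity (∏ i, (Matrix.mvPolynomialX (Fin n) (Fin n) k) (ρ i) i) ≤ n := by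
    intro ρ
    calc complexity (∏ i, (Matrix.mvPolynomialX (Fin n) (Fin n) k) (ρ i) i)
        ≤ ∑ i, complexity ((Matrix.mvPolynomialX (Fin n) (Fin n) k) (ρ i) i) +
            (Finset.univ : Finset (Fin n)).card := complexity_finset_prod_le _ _
      _ = n := by
          have h0 : ∀ i : Fin n, complexity (X (ρ i, i) : MvPolynomial (Fin n × Fin n) k) = 0 :=
            fun i => complexity_X_holds _
          simp [Matrix.mvPolynomialX_apply, h0]
  calc complexity (∑ ρ : Equiv.Perm (Fin n), ∏ i, (Matrix.mvPolynomialX (Fin n) (Fin n) k) (ρ i) i)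
      ≤ ∑ ρ : Equiv.Perm (Fin n), complexity (∏ i, (Matrix.mvPolynomialX (Fin n) (Fin n) k) (ρ i) i) +
          (Finset.univ : Finset (Equiv.Perm (Fin n))).card := complexity_finset_sum_le _ _
    _ ≤ ∑ _ρ : Equiv.Perm (Fin n), n + (Finset.univ : Finset (Equiv.Perm (Fin n))).card := by
        gcongr with ρ
        exact hprod ρ
    _ = (n + 1) * n.factorial := by
        simp only [Finset.sum_const, smul_eq_mul, Finset.card_univ, Fintype.card_perm,
          Fintype.card_fin]
        ring

/-- Elementary growth fact: `8 (n+1)^7 ≤ 2 ^ ((log₂ n + 4)^4)` for every `n`. [folklore] -/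
theorem berkowitz_bound_le_qp (n : ℕ) : 8 * (n + 1) ^ 7 ≤ 2 ^ ((Nat.log 2 n + 4) ^ 4) := by
  set L := Nat.log 2 n with hL
  have hn : n + 1 ≤ 2 ^ (L + 1) := Nat.lt_pow_succ_log_self (by norm_num) n
  have h1 : (n + 1) ^ 7 ≤ 2 ^ (7 * (L + 1)) := by
    calc (n + 1) ^ 7 ≤ (2 ^ (L + 1)) ^ 7 := Nat.pow_le_pow_left hn 7
      _ = 2 ^ (7 * (L + 1)) := by rw [← pow_mul]; ring_nf
  have h64 : 64 ≤ (L + 4) ^ 3 := by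
    calc 64 = 4 ^ 3 := by norm_num
      _ ≤ (L + 4) ^ 3 := Nat.pow_le_pow_left (by omega) 3
  have hexp : 7 * (L + 1) + 3 ≤ (L + 4) ^ 4 := by
    calc 7 * (L + 1) + 3 ≤ (L + 4) * 64 := by omega
      _ ≤ (L + 4) * (L + 4) ^ 3 := Nat.mul_le_mul_left _ h64
      _ = (L + 4) ^ 4 := by ring
  calc 8 * (n + 1) ^ 7 ≤ 8 * 2 ^ (7 * (L + 1)) := by omega
    _ = 2 ^ (7 * (L + 1) + 3) := by rw [pow_add]; ring
    _ ≤ 2 ^ ((L + 4) ^ 4) := Nat.pow_le_pow_right (by norm_num) hexp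

/-- `per_0 = 1` (the empty permanent). [folklore] -/
theorem perPoly_fin_zero : perPoly (Fin 0) k = 1 := by
  unfold perPoly
  exact Matrix.permanent_isEmpty

/-- `per_1 = x₀₀`. [folklore] -/
theorem perPoly_fin_one : perPoly (Fin 1) k = X ((0 : Fin 1), (0 : Fin 1)) := by
  unfold perPoly
  rw [Matrix.permanent_unique, Matrix.mvPolynomialX_apply]
  rfl

end Facts

/-! ### Load-bearing hypotheses of `PerDivisionHard` -/

/-- **`h ≠ 0` is load-bearing.** The crux with the hypothesis `h ≠ 0` deleted is false: `h = 0`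
makes both circuits empty. [folklore] -/
theorem perDivisionHard_false_without_nonzero :
    ¬ ∀ c : ℕ, ∃ n₀ : ℕ, ∀ n ≥ n₀, ∀ h : MvPolynomial (Fin n × Fin n) ℝ≥0,
        2 ^ ((Nat.log 2 n + c) ^ c) < complexity (perPoly (Fin n) ℝ≥0 * h) + complexity h := by
  intro H
  obtain ⟨n₀, hn₀⟩ := H 0
  have h := hn₀ n₀ le_rfl 0
  rw [mul_zero, complexity_zero] at h
  exact Nat.not_lt_zero _ h

/-- **The threshold `n₀` is load-bearing.** Claimed for every `n`, the crux is false already at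
`n = 0`, `h = 1`: `L(per_0 · 1) + L(1) = L(1) + L(1) = 0`. [folklore] -/
theorem perDivisionHard_false_without_threshold :
    ¬ ∀ c : ℕ, ∀ n : ℕ, ∀ h : MvPolynomial (Fin n × Fin n) ℝ≥0, h ≠ 0 →
        2 ^ ((Nat.log 2 n + c) ^ c) < complexity (perPoly (Fin n) ℝ≥0 * h) + complexity h := by
  intro H
  have h := H 0 0 1 one_ne_zero
  rw [mul_one, perPoly_fin_zero, complexity_one] at h
  exact Nat.not_lt_zero _ h

/-- The degenerate instance `n = 1` as well: `L(per_1 · 1) + L(1) = L(x₀₀) + L(1) = 0`, below every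
threshold `2^{(log 1 + c)^c} ≥ 1`. [folklore] -/
theorem pair_at_one_eq_zero :
    complexity (perPoly (Fin 1) ℝ≥0 * 1) + complexity (1 : MvPolynomial (Fin 1 × Fin 1) ℝ≥0) = 0 := by
  rw [mul_one, perPoly_fin_one, complexity_X_holds, complexity_one]

/-- **The dependence `c ↦ n₀(c)` is load-bearing.** With the quantifiers swapped (one `n₀` for all
`c`) the crux is false: at `n = n₀`, `h = 1` the cost is a fixed number `D`, while
`2^{(log n₀ + c)^c} > D` for `c = D + 1`. [folklore] -/
theorem perDivisionHard_false_uniform :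
    ¬ ∃ n₀ : ℕ, ∀ c : ℕ, ∀ n ≥ n₀, ∀ h : MvPolynomial (Fin n × Fin n) ℝ≥0, h ≠ 0 →
        2 ^ ((Nat.log 2 n + c) ^ c) < complexity (perPoly (Fin n) ℝ≥0 * h) + complexity h := by
  rintro ⟨n₀, H⟩
  set D := complexity (perPoly (Fin n₀) ℝ≥0 * 1) + complexity (1 : MvPolynomial (Fin n₀ × Fin n₀) ℝ≥0)
    with hD
  have h := H (D + 1) n₀ le_rfl 1 one_ne_zero
  rw [← hD] at h
  have h1 : D + 1 ≤ (Nat.log 2 n₀ + (D + 1)) ^ (D + 1) := by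
    calc D + 1 ≤ Nat.log 2 n₀ + (D + 1) := Nat.le_add_left _ _
      _ = (Nat.log 2 n₀ + (D + 1)) ^ 1 := (pow_one _).symm
      _ ≤ (Nat.log 2 n₀ + (D + 1)) ^ (D + 1) := Nat.pow_le_pow_right (by omega) (by omega)
  have h2 : (Nat.log 2 n₀ + (D + 1)) ^ (D + 1) < 2 ^ ((Nat.log 2 n₀ + (D + 1)) ^ (D + 1)) :=
    Nat.lt_two_pow_self
  omega

/-- **Monotonicity (no cancellation in `ℝ≥0`) is load-bearing.** The crux with the coefficient
semiring `ℝ≥0` replaced by a nontrivial commutative ring `k` of characteristic two is false: there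
`per_n = det_n` (`perPoly_eq_detPoly_of_charP_two`) and `L(det_n) ≤ 8(n+1)^7`
(`complexity_detPoly_le`, Berkowitz), so `h = 1` is a polynomial-size pair; witness `c = 4`, any `n`.
[cite: Burgisser2000, §2.1] -/
theorem perDivisionHard_false_of_charTwo (k : Type) [CommRing k] [CharP k 2] [Nontrivial k] :
    ¬ ∀ c : ℕ, ∃ n₀ : ℕ, ∀ n ≥ n₀, ∀ h : MvPolynomial (Fin n × Fin n) k, h ≠ 0 →
        2 ^ ((Nat.log 2 n + c) ^ c) < complexity (perPoly (Fin n) k * h) + complexity h := by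
  intro H
  obtain ⟨n₀, hn₀⟩ := H 4
  have h := hn₀ n₀ le_rfl 1 one_ne_zero
  rw [mul_one, complexity_one, add_zero, perPoly_eq_detPoly_of_charP_two] at h
  have hdet := complexity_detPoly_le k n₀
  have hqp := berkowitz_bound_le_qp n₀
  omega

/-- The instance `k = 𝔽₂` of `perDivisionHard_false_of_charTwo`. [cite: Burgisser2000, §2.1] -/
theorem perDivisionHard_false_over_zmod2 :
    ¬ ∀ c : ℕ, ∃ n₀ : ℕ, ∀ n ≥ n₀, ∀ h : MvPolynomial (Fin n × Fin n) (ZMod 2), h ≠ 0 →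
        2 ^ ((Nat.log 2 n + c) ^ c) < complexity (perPoly (Fin n) (ZMod 2) * h) + complexity h :=
  perDivisionHard_false_of_charTwo (ZMod 2)

/-! ### Tightness window -/

/-- **The trivial pair.** With `h = 1` the "division complexity" `L(per_n · h) + L(h)` of the crux is
at most `(n + 1) · n!` (and at most `n · 2^n` by Jerrum–Snir's Laplace expansion, not used).
[cite: JerrumSnir1982, §4.3] -/
theorem exists_pair_le_factorial (n : ℕ) :
    ∃ h : MvPolynomial (Fin n × Fin n) ℝ≥0, h ≠ 0 ∧
      complexity (perPoly (Fin n) ℝ≥0 * h) + complexity h ≤ (n + 1) * n.factorial := by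
  refine ⟨1, one_ne_zero, ?_⟩
  rw [mul_one, complexity_one, add_zero]
  exact complexity_perPoly_le_factorial n

/-- **Refuted strengthening (factorial rate).** The quasi-polynomial threshold of the crux cannot be
raised to `(n+1)·n!`: for no `n₀` does every nonzero `h` satisfy `(n+1)·n! < L(per_n · h) + L(h)`
for all `n ≥ n₀` (witness `h = 1`). [cite: JerrumSnir1982, §4.3] -/
theorem perDivisionHard_false_at_factorial_rate :
    ¬ ∃ n₀ : ℕ, ∀ n ≥ n₀, ∀ h : MvPolynomial (Fin n × Fin n) ℝ≥0, h ≠ 0 →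
        (n + 1) * n.factorial < complexity (perPoly (Fin n) ℝ≥0 * h) + complexity h := by
  rintro ⟨n₀, H⟩
  obtain ⟨h, hne, hle⟩ := exists_pair_le_factorial n₀
  exact absurd (H n₀ le_rfl h hne) (not_lt.mpr hle)

end Summit.ValiantsHypothesis.Theorems.PerDivisionHardNegative

end
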